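import Summits.CriticalPhenomena.PercolationContinuityZ3.Theorems.PercNearOneGluingNoHeavyLowerTailSahiSlotPairCone
import Summits.CriticalPhenomena.PercolationContinuityZ3.Theorems.PercNearOneGluingNoHeavyLowerTailSahiGridPatternOrthant

/-!
# The two instance-blind lifts of the pattern functional as EXACT IDENTITIES (every dimension):
# `sStarD (D × {1,2}) B C = Σ_{j,k∈{1,2}} sStarD D B_j C_k + remTwo`, `sStarD (E × {2}) B C = 2·sStarD E B₂ C₂ + remTop`

Support file of the one-cut programme (crux `NoHeavyLowerTail`, stmt-CriticalPhenomena-4575; cell `prim-masterthm`, seat P3, gen 23;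
`run/shared/lean/prim/prim-masterthm/prim-masterthm-p3/HIERARCHY.md` §31, memo `FROM-prim-masterthm-p3-g23-FORMAT-LIFTS.md`).

CONTEXT.  prim-sahi-p1's orthant induction (`…SahiGridPatternOrthant`, `…TopOnlyTop`, generation 9) rests on two INSTANCE-BLIND lifts at
the VALUE level: for up-sets `D ⊆ [3]^n` and arbitrary up-sets `B, C ⊆ [3]^{n+1}` with last-axis slices `B_j, C_k`,
`Σ_{j,k∈{1,2}} sStarD D B_j C_k ≤ sStarD (D × {1,2}) B C` and `2·sStarD E B₂ C₂ ≤ sStarD (E × {2}) B C`, proved there as inequalities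
(`linarith` over fibre-Kleitman and monotonicity slacks).  THIS FILE turns both into EXACT IDENTITIES with an explicit ten-term remainder
(`SahiSlot.remTwo`, `SahiSlot.remTop`), valid for ALL finsets `D, B, C` (no up-set hypothesis):
* typed pair-sum atoms on functions `[3]^n → ℤ`: `Dg` (diagonal), `Nf` (totally-distinct pair, single function at the first point),
  `Lf` (Latin: third point), their multilinearity, and prim-sahi-p1's `block_eq` / `sStarD_counting` restated in atoms;
* the lifted sets `liftTwo D = D × {1,2}`, `liftTop D = D × {2}` (last axis) and the slices `sl X j`;
* **`sStarD_liftTwo_eq`**, **`sStarD_liftTop_eq`** — the identities (proof: the 18 resp. 9 level blocks of the slice expansion, per-axis counts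
  `c_vals_liftTwo` / `c_vals_top` of prim-sahi-p1, and `ring`).
The remainder terms are, by kind: fibre-Kleitman `Σ_{p δ̸ q} v(p)·y(q)·(1_D(q) − 1_D(p̄q))` with a vertical increment `v` of one member as free
argument and a level `y` of the other; point × vertical increment weighted by `ν_D`; vertical increment × vertical increment (diagonal with
weight `2·2^n·1_D`, and at totally distinct pairs).  The identities were FOUND by linear programming over a dictionary of such atoms
(gen 23, `code-g23/identfind*.py`, exact on all up-sets of `[3]^1, [3]^2`) and verified symbolically in the atom algebra before this kernel proof.
The companion file `…SahiSlotPairConeLiftCert` shows every remainder term is in the pinned pair cone `C ⊗ C` (gen 22's Harris-form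
certificate on the Boolean cube of points totally distinct from `p` handles the fibre-Kleitman kind), giving the FORMAT-LEVEL lifts
`PinnedGood n D → PinnedGood (n+1) (D × {1,2})`, `→ PinnedGood (n+1) (D × {2})`.
HONEST LABEL: exact bookkeeping identities; no open cell changes status.  Pure, standard axioms. [this work]
-/

noncomputable section

namespace Summit.CriticalPhenomena.PercolationContinuityZ3.Theorems

open Finset Function

namespace SahiSlot

open SahiGridPattern SahiGrid3

variable {n : ℕ}

/-! ### Typed pair-sum atoms (functions on `[3]^n`) -/

/-- Diagonal atom `Σ_p f(p) g(p) h(p)`. [this work] -/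
def Dg (f g h : Pd n → ℤ) : ℤ := ∑ p, f p * g p * h p

/-- Opposite-pair atom `Σ_{p δ̸ q} f(p) g(q) h(q)` (single function at `p`, pair at `q`). [this work] -/
def Nf (f g h : Pd n → ℤ) : ℤ := ∑ p, ∑ q, f p * g q * h q * (if TotDist p q = true then (1:ℤ) else 0)

/-- Latin atom `Σ_{q δ̸ r} g(q) h(r) f(q̄r)` (`f` at the third point of the Latin line). [this work] -/
def Lf (f g h : Pd n → ℤ) : ℤ := ∑ q, ∑ r, g q * h r * f (thirdPt q r) * (if TotDist q r = true then (1:ℤ) else 0)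

/-- Multilinearity of `Dg` (second slot). [this work] -/
theorem Dg_sub₂ (f g g' h : Pd n → ℤ) : Dg f (g - g') h = Dg f g h - Dg f g' h := by
  simp only [Dg, Pi.sub_apply, ← Finset.sum_sub_distrib]; exact Finset.sum_congr rfl fun p _ => by ring
/-- Multilinearity of `Dg` (third slot). [this work] -/
theorem Dg_sub₃ (f g h h' : Pd n → ℤ) : Dg f g (h - h') = Dg f g h - Dg f g h' := by
  simp only [Dg, Pi.sub_apply, ← Finset.sum_sub_distrib]; exact Finset.sum_congr rfl fun p _ => by ring
/-- Multilinearity of `Nf` (first slot). [this work] -/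
theorem Nf_sub₁ (f f' g h : Pd n → ℤ) : Nf (f - f') g h = Nf f g h - Nf f' g h := by
  simp only [Nf, Pi.sub_apply, ← Finset.sum_sub_distrib]
  exact Finset.sum_congr rfl fun p _ => Finset.sum_congr rfl fun q _ => by ring
/-- Multilinearity of `Nf` (second slot). [this work] -/
theorem Nf_sub₂ (f g g' h : Pd n → ℤ) : Nf f (g - g') h = Nf f g h - Nf f g' h := by
  simp only [Nf, Pi.sub_apply, ← Finset.sum_sub_distrib]
  exact Finset.sum_congr rfl fun p _ => Finset.sum_congr rfl fun q _ => by ring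
/-- Multilinearity of `Nf` (third slot). [this work] -/
theorem Nf_sub₃ (f g h h' : Pd n → ℤ) : Nf f g (h - h') = Nf f g h - Nf f g h' := by
  simp only [Nf, Pi.sub_apply, ← Finset.sum_sub_distrib]
  exact Finset.sum_congr rfl fun p _ => Finset.sum_congr rfl fun q _ => by ring
/-- Multilinearity of `Lf` (second slot). [this work] -/
theorem Lf_sub₂ (f g g' h : Pd n → ℤ) : Lf f (g - g') h = Lf f g h - Lf f g' h := by
  simp only [Lf, Pi.sub_apply, ← Finset.sum_sub_distrib]
  exact Finset.sum_congr rfl fun p _ => Finset.sum_congr rfl fun q _ => by ring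
/-- Multilinearity of `Lf` (third slot). [this work] -/
theorem Lf_sub₃ (f g h h' : Pd n → ℤ) : Lf f g (h - h') = Lf f g h - Lf f g h' := by
  simp only [Lf, Pi.sub_apply, ← Finset.sum_sub_distrib]
  exact Finset.sum_congr rfl fun p _ => Finset.sum_congr rfl fun q _ => by ring

/-- One level block of the slice expansion, in atoms (prim-sahi-p1's `block_eq`). [this work] -/
theorem block_eq_atoms (S T R : Finset (Pd n)) (i j k : Fin 3) :
    (∑ p, ∑ q, ∑ r, ind S p * ind T q * ind R r * tcD (Fin.snoc p i : Pd (n + 1)) (Fin.snoc q j) (Fin.snoc r k)) =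
      c1 i j k * (2 * 2 ^ n * Dg (ind S) (ind T) (ind R)) - c2 i j k * Nf (ind S) (ind T) (ind R)
      - c2 j i k * Nf (ind T) (ind S) (ind R) - c2 k i j * Nf (ind R) (ind S) (ind T) + c3 i j k * Lf (ind S) (ind T) (ind R) := by
  unfold Dg Nf Lf; exact block_eq S T R i j k

/-- The counting form of `sStarD`, in atoms (prim-sahi-p1's `sStarD_counting`). [this work] -/
theorem sStarD_counting_atoms (X Y Z : Finset (Pd n)) :
    sStarD X Y Z = 2 * 2 ^ n * Dg (ind X) (ind Y) (ind Z) - Nf (ind X) (ind Y) (ind Z) - Nf (ind Y) (ind X) (ind Z)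
      - Nf (ind Z) (ind X) (ind Y) + Lf (ind X) (ind Y) (ind Z) := by
  unfold Dg Nf Lf; exact sStarD_counting X Y Z

/-! ### Slices, and the two lifted sets -/

/-- The level-`j` slice of `X ⊆ [3]^{n+1}` along the last axis. [this work] -/
def sl (X : Finset (Pd (n + 1))) (j : Fin 3) : Finset (Pd n) := univ.filter fun p => (Fin.snoc p j : Pd (n + 1)) ∈ X

/-- Indicator of a slice. [this work] -/
theorem ind_sl (X : Finset (Pd (n + 1))) (j : Fin 3) (p : Pd n) : ind X (Fin.snoc p j) = ind (sl X j) p :=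
  (ind_filter_snoc X j p).symm

/-- Slices of up-sets are up-sets. [this work] -/
theorem isUpperSet_sl {X : Finset (Pd (n + 1))} (hX : IsUpperSet (X : Set (Pd (n + 1)))) (j : Fin 3) :
    IsUpperSet ((sl X j : Finset (Pd n)) : Set (Pd n)) := isUpperSet_filter_snoc hX j

/-- Indicator of the empty set. [this work] -/
theorem ind_empty_eq (p : Pd n) : ind (∅ : Finset (Pd n)) p = 0 := by unfold ind; simp

/-- **The two-level lift** `D × {1,2} ⊆ [3]^{n+1}` (last axis). [this work] -/
def liftTwo (D : Finset (Pd n)) : Finset (Pd (n + 1)) := univ.filter fun x => Fin.init x ∈ D ∧ x (Fin.last n) ≠ 0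

/-- **The top-only lift** `D × {2} ⊆ [3]^{n+1}` (last axis). [this work] -/
def liftTop (D : Finset (Pd n)) : Finset (Pd (n + 1)) := univ.filter fun x => Fin.init x ∈ D ∧ x (Fin.last n) = 2

/-- Membership of a `snoc` point in the two-level lift. [this work] -/
theorem snoc_mem_liftTwo (D : Finset (Pd n)) (p : Pd n) (i : Fin 3) : (Fin.snoc p i : Pd (n + 1)) ∈ liftTwo D ↔ p ∈ D ∧ i ≠ 0 := by
  simp [liftTwo, Fin.init_snoc, Fin.snoc_last]

/-- Membership of a `snoc` point in the top-only lift. [this work] -/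
theorem snoc_mem_liftTop (D : Finset (Pd n)) (p : Pd n) (i : Fin 3) : (Fin.snoc p i : Pd (n + 1)) ∈ liftTop D ↔ p ∈ D ∧ i = 2 := by
  simp [liftTop, Fin.init_snoc, Fin.snoc_last]

/-- Bottom slice of `D × {1,2}` is empty. [this work] -/
theorem sl_liftTwo_zero (D : Finset (Pd n)) : sl (liftTwo D) 0 = ∅ := by
  ext p; simp [sl, snoc_mem_liftTwo]
/-- Middle slice of `D × {1,2}` is `D`. [this work] -/
theorem sl_liftTwo_one (D : Finset (Pd n)) : sl (liftTwo D) 1 = D := by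
  ext p; simp [sl, snoc_mem_liftTwo]
/-- Top slice of `D × {1,2}` is `D`. [this work] -/
theorem sl_liftTwo_two (D : Finset (Pd n)) : sl (liftTwo D) 2 = D := by
  ext p; simp [sl, snoc_mem_liftTwo]
/-- Bottom slice of `D × {2}` is empty. [this work] -/
theorem sl_liftTop_zero (D : Finset (Pd n)) : sl (liftTop D) 0 = ∅ := by
  ext p; simp [sl, snoc_mem_liftTop]
/-- Middle slice of `D × {2}` is empty. [this work] -/
theorem sl_liftTop_one (D : Finset (Pd n)) : sl (liftTop D) 1 = ∅ := by
  ext p; simp [sl, snoc_mem_liftTop]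
/-- Top slice of `D × {2}` is `D`. [this work] -/
theorem sl_liftTop_two (D : Finset (Pd n)) : sl (liftTop D) 2 = D := by
  ext p; simp [sl, snoc_mem_liftTop]

/-- The two-level lift of an up-set is an up-set. [this work] -/
theorem isUpperSet_liftTwo {D : Finset (Pd n)} (hD : IsUpperSet (D : Set (Pd n))) : IsUpperSet ((liftTwo D : Finset (Pd (n + 1))) : Set (Pd (n + 1))) := by
  intro x y hxy hx
  rw [Finset.mem_coe] at hx ⊢
  simp only [liftTwo, Finset.mem_filter, Finset.mem_univ, true_and] at hx ⊢
  refine ⟨hD (fun a => hxy (Fin.castSucc a)) hx.1, fun h0 => hx.2 ?_⟩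
  have := hxy (Fin.last n); rw [h0] at this; exact le_antisymm this (Fin.zero_le _)

/-- The top-only lift of an up-set is an up-set. [this work] -/
theorem isUpperSet_liftTop {D : Finset (Pd n)} (hD : IsUpperSet (D : Set (Pd n))) : IsUpperSet ((liftTop D : Finset (Pd (n + 1))) : Set (Pd (n + 1))) := by
  intro x y hxy hx
  rw [Finset.mem_coe] at hx ⊢
  simp only [liftTop, Finset.mem_filter, Finset.mem_univ, true_and] at hx ⊢
  refine ⟨hD (fun a => hxy (Fin.castSucc a)) hx.1, ?_⟩
  have := hxy (Fin.last n); rw [hx.2] at this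
  exact le_antisymm (Fin.le_last _) (by simpa using this)

/-! ### The two remainders and the two identities -/

/-- The explicit remainder of the two-level lift (ten terms: fibre-Kleitman, monotone, increment×increment). [this work] -/
def remTwo (D : Finset (Pd n)) (B C : Finset (Pd (n + 1))) : ℤ :=
  (Nf (ind (sl B 1) - ind (sl B 0)) (ind D) (ind (sl C 1)) - Lf (ind D) (ind (sl B 1) - ind (sl B 0)) (ind (sl C 1)))
  + (Nf (ind (sl B 2) - ind (sl B 0)) (ind D) (ind (sl C 2)) - Lf (ind D) (ind (sl B 2) - ind (sl B 0)) (ind (sl C 2)))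
  + (Nf (ind (sl C 1) - ind (sl C 0)) (ind D) (ind (sl B 2)) - Lf (ind D) (ind (sl B 2)) (ind (sl C 1) - ind (sl C 0)))
  + (Nf (ind (sl C 2) - ind (sl C 0)) (ind D) (ind (sl B 1)) - Lf (ind D) (ind (sl B 1)) (ind (sl C 2) - ind (sl C 0)))
  + Nf (ind D) (ind (sl B 0)) (ind (sl C 1) - ind (sl C 0)) + Nf (ind D) (ind (sl B 0)) (ind (sl C 2) - ind (sl C 0))
  + Nf (ind D) (ind (sl B 2) - ind (sl B 0)) (ind (sl C 1)) + Nf (ind D) (ind (sl B 1) - ind (sl B 0)) (ind (sl C 2))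
  + 2 * 2 ^ n * Dg (ind D) (ind (sl B 2) - ind (sl B 1)) (ind (sl C 2) - ind (sl C 1))
  + Nf (ind (sl C 2) - ind (sl C 1)) (ind D) (ind (sl B 2) - ind (sl B 1))

/-- The explicit remainder of the top-only lift (ten terms). [this work] -/
def remTop (E : Finset (Pd n)) (B C : Finset (Pd (n + 1))) : ℤ :=
  (Nf (ind (sl B 2) - ind (sl B 0)) (ind E) (ind (sl C 1)) - Lf (ind E) (ind (sl B 2) - ind (sl B 0)) (ind (sl C 1)))
  + (Nf (ind (sl B 2) - ind (sl B 1)) (ind E) (ind (sl C 0)) - Lf (ind E) (ind (sl B 2) - ind (sl B 1)) (ind (sl C 0)))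
  + (Nf (ind (sl C 2) - ind (sl C 0)) (ind E) (ind (sl B 2)) - Lf (ind E) (ind (sl B 2)) (ind (sl C 2) - ind (sl C 0)))
  + (Nf (ind (sl C 2) - ind (sl C 1)) (ind E) (ind (sl B 2)) - Lf (ind E) (ind (sl B 2)) (ind (sl C 2) - ind (sl C 1)))
  + Nf (ind E) (ind (sl B 0)) (ind (sl C 2) - ind (sl C 0)) + Nf (ind E) (ind (sl B 1)) (ind (sl C 2) - ind (sl C 1))
  + Nf (ind E) (ind (sl B 2) - ind (sl B 0)) (ind (sl C 2)) + Nf (ind E) (ind (sl B 2) - ind (sl B 1)) (ind (sl C 2))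
  + Nf (ind (sl B 2) - ind (sl B 0)) (ind E) (ind (sl C 2) - ind (sl C 1))
  + Nf (ind (sl B 2) - ind (sl B 1)) (ind E) (ind (sl C 2) - ind (sl C 0))

/-- **THE TWO-LEVEL IDENTITY** (every `n`, all finsets): `sStarD (D × {1,2}) B C = Σ_{j,k ∈ {1,2}} sStarD D B_j C_k + remTwo D B C`. [this work] -/
theorem sStarD_liftTwo_eq (D : Finset (Pd n)) (B C : Finset (Pd (n + 1))) :
    sStarD (liftTwo D) B C = (sStarD D (sl B 1) (sl C 1) + sStarD D (sl B 1) (sl C 2) + sStarD D (sl B 2) (sl C 1)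
      + sStarD D (sl B 2) (sl C 2)) + remTwo D B C := by
  rw [sStarD_eq_sum_ind]
  simp only [sum_snoc, Fin.sum_univ_three, ind_sl, sl_liftTwo_zero, sl_liftTwo_one, sl_liftTwo_two, ind_empty_eq, zero_mul,
    Finset.sum_const_zero, zero_add, Finset.sum_add_distrib]
  rw [block_eq_atoms, block_eq_atoms, block_eq_atoms, block_eq_atoms, block_eq_atoms, block_eq_atoms, block_eq_atoms, block_eq_atoms,
    block_eq_atoms, block_eq_atoms, block_eq_atoms, block_eq_atoms, block_eq_atoms, block_eq_atoms, block_eq_atoms, block_eq_atoms,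
    block_eq_atoms, block_eq_atoms]
  obtain ⟨h0, h1, h2, h3, h4, h5, h6, h7, h8, h9, h10, h11, h12, h13, h14, h15, h16, h17, h18, h19, h20, h21, h22, h23, h24, h25, h26, h27, h28, h29, h30, h31, h32, h33, h34, h35, h36, h37, h38, h39, h40, h41, h42, h43, h44, h45, h46, h47, h48, h49, h50, h51, h52, h53, h54, h55, h56, h57, h58, h59⟩ := c_vals_liftTwo
  simp only [h0, h1, h2, h3, h4, h5, h6, h7, h8, h9, h10, h11, h12, h13, h14, h15, h16, h17, h18, h19, h20, h21, h22, h23, h24, h25, h26, h27, h28, h29, h30, h31, h32, h33, h34, h35, h36, h37, h38, h39, h40, h41, h42, h43, h44, h45, h46, h47, h48, h49, h50, h51, h52, h53, h54, h55, h56, h57, h58, h59]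
  rw [sStarD_counting_atoms, sStarD_counting_atoms, sStarD_counting_atoms, sStarD_counting_atoms]
  simp only [remTwo, Nf_sub₁, Nf_sub₂, Nf_sub₃, Dg_sub₂, Dg_sub₃, Lf_sub₂, Lf_sub₃]
  ring

/-- **THE TOP-ONLY IDENTITY** (every `n`, all finsets): `sStarD (E × {2}) B C = 2·sStarD E B₂ C₂ + remTop E B C`. [this work] -/
theorem sStarD_liftTop_eq (E : Finset (Pd n)) (B C : Finset (Pd (n + 1))) :
    sStarD (liftTop E) B C = 2 * sStarD E (sl B 2) (sl C 2) + remTop E B C := by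
  rw [sStarD_eq_sum_ind]
  simp only [sum_snoc, Fin.sum_univ_three, ind_sl, sl_liftTop_zero, sl_liftTop_one, sl_liftTop_two, ind_empty_eq, zero_mul,
    Finset.sum_const_zero, zero_add, Finset.sum_add_distrib]
  rw [block_eq_atoms, block_eq_atoms, block_eq_atoms, block_eq_atoms, block_eq_atoms, block_eq_atoms, block_eq_atoms, block_eq_atoms,
    block_eq_atoms]
  obtain ⟨a1, a2, a3, a4, a5, a6, a7, a8, a9, b1, b2, b3, b4, b5, b6, b7, b8, b9, d1, d2, d3, d4, d5, d6, f1, f2, f3, f4, f5, f6, f7, f8, f9⟩ := c_vals_top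
  rw [a1, a2, a3, a4, a5, a6, a7, a8, a9, b1, b2, b3, b4, b5, b6, b7, b8, b9, d1, d2, d3, d4, d5, d6, f1, f2, f3, f4, f5, f6, f7, f8, f9]
  rw [sStarD_counting_atoms]
  simp only [remTop, Nf_sub₁, Nf_sub₂, Nf_sub₃, Lf_sub₂, Lf_sub₃]
  ring

end SahiSlot

end Summit.CriticalPhenomena.PercolationContinuityZ3.Theorems
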